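import Mathlib
import Summits.ResolutionOfSingularities.ResolutionOfSingularities.Theorems.WildQuotientsWildQuotientResolutionJordanFiveChartW1SectionsModel
import Summits.ResolutionOfSingularities.ResolutionOfSingularities.Theorems.WildQuotientsWildQuotientResolutionJordanFiveX1ChartRing
import Summits.ResolutionOfSingularities.ResolutionOfSingularities.Theorems.WildQuotientsWildQuotientResolutionJordanFiveTwistedChartAction
import Summits.ResolutionOfSingularities.ResolutionOfSingularities.Theorems.WildQuotientsWildQuotientResolutionJordanFiveChartW1Side
import Summits.ResolutionOfSingularities.ResolutionOfSingularities.Theorems.WildQuotientsWildQuotientResolutionJordanFourChartWRing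
import Summits.ResolutionOfSingularities.ResolutionOfSingularities.Theorems.WildQuotientsWildQuotientResolutionJordanFourHalfConeAway
import Summits.ResolutionOfSingularities.ResolutionOfSingularities.Theorems.WildQuotientsWildQuotientResolutionBlowupExitBasicOpenSections

/-!
# RUNG V5 (J₅), brick H₁ RING SIDE on the chart ring `B_{W₁} = (k[x][I₁₂t])_{(H′²t·T′²H′t²)}`, modulo the seam

(crux stmt-ResolutionOfSingularities-15640 `WildQuotients.WildQuotientResolution`, line `Sketch`;
chain w45c RUNG V5 `JordanFive.jordanFive_hasResolution_of_bricks` (res-L1-w45c-lead-1), brick H₁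
(`L/w45c/CHAIN.md` v8.4 §4: H₁ = stub-1; ring model = res-L1-w45c-stub-2 p531492; seam = stub-5
p527645; adapter `coneBrick_one_of_ringBrick` = lead-1). J₅ twin of this seat's
`JordanFour.exists_ringBrick_T_chartW` (p517131). [OURS · L1 W4.5c] — NOT a statement of any
manuscript (Hironaka 2017 is consumed nowhere); replaces the role of no printed item. Prover
res-L1-w45c-stub-1. AI-written Lean, kernel-checked; weaker than expert review.)

`exists_ringBrick_X1_chartW₁`: for the graded endomorphisms `φ_g` of the seam (coefficient law
`hφ`) and ANY ratios `t_j ∈ B_{W₁}` with `(H′²/1)·t_j = g_j/1` (`j ≠ 1`): `∃ R₀ J₀ (ψC : R₀ →+* B_{W₁})`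
injective, `range ψC = {y | ∀ g, φ_g y = y}`, `J₀` radical, `Bl_{J₀}` regular, and
`√(ψC⁻¹⟨x_a/1, x_b/1, x_c/1, x_d/1, t_j⟩) = J₀`. Assembly: `L := k[x][1/Q]`, `τ_L :=` the localised
translation `Σ_l` (`JordanFour.exists_translate`/`exists_localize_algHom`), `eE :=`
`exists_chartW₁Sections_ringEquiv_cubicModel`, the model brick `exists_ringBrick_X1_model` (stub-2),
and the range conversion «`τ_L`-fixed ↔ fixed by every `φ_g`» by stub-5's degree-`m` E-engine
`BlowupExit.map_away_eq_of_intertwines_deg` (section coefficient `H′²·T′²H′` is `⟨σ⟩`-invariant: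
stub-5's `smul_chartW₁_coeff`) and `JordanFive.exists_twistedChart_expo_algebraMap_and_fixed_iff`.
-/

-- single-problem summit: the doubled namespace component `ResolutionOfSingularities` is forced
set_option linter.dupNamespace false

noncomputable section

open MvPolynomial AlgebraicGeometry HomogeneousLocalization Literature.AlgebraicGeometry.Resolution

namespace Summit.ResolutionOfSingularities.ResolutionOfSingularities.Theorems.WildQuotientResolution.JordanFive

variable (k : Type) [Field k] (n : ℕ) (a b c d e : Fin n)

/-- The section `s_{W₁} = H′²t · T′²H′t²` defining `chartW₁`. -/
local notation3 "sW₁" => (reesT (JordanFour.hPrime k n a b c ^ 2) (hPrime_sq_mem_I12 k n a b c d) *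
  tSqHT2 k n a b c d)
/-- The chart ring `B_{W₁} = (k[x][I₁₂t])_{(s_{W₁})}`. -/
local notation3 "BW₁" => HomogeneousLocalization.Away (reesGrading (I12 k n a b c d)) sW₁
/-- The base map `f ↦ f/1`. -/
local notation3 "base₁" => ((HomogeneousLocalization.fromZeroRingHom (reesGrading (I12 k n a b c d))
    (.powers sW₁)).comp (reesGrading.zeroRingHom (I12 k n a b c d)))

/-- `s_{W₁}` is homogeneous of degree `3`. [folklore] -/
theorem sectionW₁_mem : (sW₁ : reesAlgebra (I12 k n a b c d)) ∈ reesGrading (I12 k n a b c d) 3 :=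
  chartW₁_section_mem k n a b c d

-- the statement quantifies over the seam's data; elaboration needs head-room
set_option maxHeartbeats 1600000 in
/-- **The ring brick `H₁` on the chart ring `B_{W₁}`, modulo the seam** (see the module docstring).
[OURS · L1 W4.5c] [folklore; assembly of landed decls] -/
theorem exists_ringBrick_X1_chartW₁ (p : ℕ) (hp : p.Prime) (hp5 : 5 ≤ p) [CharP k p]
    (σ : MvPolynomial (Fin n) k ≃ₐ[k] MvPolynomial (Fin n) k) [Finite ↥(Subgroup.zpowers σ)]
    (hab : a ≠ b) (hac : a ≠ c) (had : a ≠ d) (hae : a ≠ e) (hbc : b ≠ c) (hbd : b ≠ d) (hbe : b ≠ e)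
    (hcd : c ≠ d) (hce : c ≠ e) (hde : d ≠ e)
    (hσb : σ (X b) = X b + X a) (hσc : σ (X c) = X c + X b) (hσd : σ (X d) = X d + X c)
    (hσe : σ (X e) = X e + X d)
    (hσ : ∀ i, i ≠ b → i ≠ c → i ≠ d → i ≠ e → σ (X i) = X i)
    (φ : ↥(Subgroup.zpowers σ) → (reesGrading (I12 k n a b c d) →+*ᵍ reesGrading (I12 k n a b c d)))
    (hφ : ∀ (g : ↥(Subgroup.zpowers σ)) x, ((φ g x : reesAlgebra (I12 k n a b c d)) :
        Polynomial (MvPolynomial (Fin n) k)) =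
      (x : Polynomial (MvPolynomial (Fin n) k)).map ((MulSemiringAction.toRingEquiv
        (↥(Subgroup.zpowers σ)) (MvPolynomial (Fin n) k) g⁻¹ : _ ≃+* _) : _ →+* _))
    (hP : ∀ g, Submonoid.powers sW₁ ≤ (Submonoid.powers sW₁).comap (φ g))
    (t : {j : Fin 40 // j ≠ 1} → BW₁)
    (ht : ∀ j, base₁ (JordanFour.hPrime k n a b c ^ 2) * t j = base₁ (gens12 k n a b c d j.1)) :
    ∃ (R₀ : Type) (_ : CommRing R₀) (J₀ : Ideal R₀) (ψC : R₀ →+* BW₁),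
      Function.Injective ψC ∧
      (∀ y : BW₁, y ∈ Set.range ψC ↔ ∀ g, HomogeneousLocalization.map (φ g) (hP g) y = y) ∧
      J₀.IsRadical ∧ Scheme.IsRegular (affineBlowup J₀) ∧
      ((Ideal.span (base₁ '' {X a, X b, X c, X d} ∪ Set.range t)).comap ψC).radical = J₀ := by
  classical
  have h2 : (2 : k) ≠ 0 := JordanFour.two_ne_zero_of_charP k p hp5
  have h3 : (3 : k) ≠ 0 := JordanFour.three_ne_zero_of_charP k p hp5
  have hσa : σ (X a) = X a := hσ a hab hac had hae
  -- the translation and its localisation at `Q`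
  obtain ⟨τ, hτc, hτ⟩ := JordanFour.exists_translate k n b c
  have hτQ : τ (JordanFour.twistedQ k n a b d) = JordanFour.twistedQ k n a b d :=
    JordanFour.translate_twistedQ k n a b c d τ hτ hac hbc hcd
  have hQne : JordanFour.twistedQ k n a b d ≠ 0 := fun h =>
    JordanFour.twistedQ_not_mem_span_X_abc k n a b c d (h ▸ Ideal.zero_mem _)
  let L : Type := Localization.Away (JordanFour.twistedQ k n a b d)
  haveI : IsDomain L :=
    IsLocalization.isDomain_localization (powers_le_nonZeroDivisors_of_noZeroDivisors hQne)
  have hinjL : Function.Injective (algebraMap (MvPolynomial (Fin n) k) L) :=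
    IsLocalization.injective L (powers_le_nonZeroDivisors_of_noZeroDivisors hQne)
  obtain ⟨τL, hτL⟩ := JordanFour.exists_localize_algHom k n (JordanFour.twistedQ k n a b d) τ hτQ L
  -- the chart model `B_{W₁} ≃ E ⊆ L`
  obtain ⟨eE, he1, he2, he3⟩ := exists_chartW₁Sections_ringEquiv_cubicModel k n a b c d e hab hac had hae
    hbc hbd hbe hcd hce hde h2 h3 L
  -- the weights of record
  have hwa := cubicWeight_a n a b c d
  have hwb := cubicWeight_b n a b c d hab
  have hwc := cubicWeight_c n a b c d hac hbc
  have hwd := cubicWeight_d n a b c d had hbd hcd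
  have hw0 : ∀ i, i ≠ a → i ≠ b → i ≠ c → i ≠ d → cubicWeight n a b c d i = 0 :=
    fun i hia hib hic hid => cubicWeight_of_ne n a b c d i hia hib hic hid
  let w₁ : Fin n → ZMod 3 := fun i => if i = c then (p : ZMod 3) else cubicWeight n a b c d i
  have hw₁a : w₁ a = 2 := by simp [w₁, hac, hwa]
  have hw₁b : w₁ b = 1 := by simp [w₁, hbc, hwb]
  have hw₁c : w₁ c = (p : ZMod 3) := by simp [w₁]
  have hw₁d : w₁ d = 2 := by simp [w₁, hcd.symm, hwd]
  have hw₁0 : ∀ i, i ≠ a → i ≠ b → i ≠ c → i ≠ d → w₁ i = 0 := by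
    intro i hia hib hic hid; simp [w₁, hic, hw0 i hia hib hic hid]
  -- the model brick (res-L1-w45c-stub-2 p531492)
  have hmodel := exists_ringBrick_X1_model k n a b c d e hab hac had hbc hbd hcd p hp hp5
    (cubicWeight n a b c d) hwa hwb hwc hwd hw0 w₁ hw₁a hw₁b hw₁c hw₁d hw₁0 τ hτc hτ (L := L) τL hτL _ rfl
    (C := BW₁) base₁ eE (fun F => he1 F) t ht
  obtain ⟨R₀, _, J₀, ψC, hinj, hrangeτ, hrad, hreg, hJ⟩ := hmodel
  -- the exponent function of `⟨σ⟩` on the universal twisted chart (p524589)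
  obtain ⟨m, -, hmg, hfix⟩ := exists_twistedChart_expo_algebraMap_and_fixed_iff k n a b c d e hab hac
    had hae hbc hbd hbe hcd hce hde τ hτc hτ σ hσb hσc hσd hσe hσ h2 h3 (S := L) τL hτL
  -- the model as a ring map `e' : B_{W₁} → L`
  let e' : BW₁ →+* L := (Algebra.adjoin k (algebraMap (MvPolynomial (Fin n) k) L ''
      (ThirdCone.cone k n (cubicWeight n a b c d) : Set (MvPolynomial (Fin n) k)) ∪
      {IsLocalization.Away.invSelf (S := L) (JordanFour.twistedQ k n a b d)})).val.toRingHom.comp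
    eE.toRingHom
  have he' : ∀ y, e' y = ((eE y : Algebra.adjoin k (algebraMap (MvPolynomial (Fin n) k) L ''
      (ThirdCone.cone k n (cubicWeight n a b c d) : Set (MvPolynomial (Fin n) k)) ∪
      {IsLocalization.Away.invSelf (S := L) (JordanFour.twistedQ k n a b d)})) : L) := fun y => rfl
  have he'inj : Function.Injective e' := Subtype.val_injective.comp eE.injective
  have he'base : ∀ F, e' (base₁ F) = algebraMap (MvPolynomial (Fin n) k) L (twistedChart k n a b c d e F) :=
    fun F => he1 F
  -- the E-engine in degree `3` for every `g`
  have hnzd : e' (base₁ (JordanFour.hPrime k n a b c ^ 2 *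
      (JordanFour.tPrime k n a b c d ^ 2 * JordanFour.hPrime k n a b c))) ∈ nonZeroDivisors L := by
    apply mem_nonZeroDivisors_of_ne_zero
    rw [he'base, map_ne_zero_iff _ hinjL, map_mul, map_mul, map_pow, map_pow,
      twistedChart_tPrime k n a b c d e hab hac had hbc hbd hcd h2 h3,
      twistedChart_hPrime k n a b c d e hab hac hbc h2]
    exact mul_ne_zero (pow_ne_zero 2 (mul_ne_zero (pow_ne_zero 6 (X_ne_zero b)) hQne))
      (mul_ne_zero (pow_ne_zero 2 (mul_ne_zero (pow_ne_zero 9 (X_ne_zero b)) hQne))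
        (mul_ne_zero (pow_ne_zero 6 (X_ne_zero b)) hQne))
  have hengine : ∀ (g : ↥(Subgroup.zpowers σ)) (y : BW₁),
      e' (HomogeneousLocalization.map (φ g) (hP g) y) = (τL ^ m g⁻¹) (e' y) := by
    intro g y
    have hcoeff : MulSemiringAction.toRingEquiv (↥(Subgroup.zpowers σ)) (MvPolynomial (Fin n) k) g⁻¹
        (JordanFour.hPrime k n a b c ^ 2 * (JordanFour.tPrime k n a b c d ^ 2 * JordanFour.hPrime k n a b c)) =
        JordanFour.hPrime k n a b c ^ 2 * (JordanFour.tPrime k n a b c d ^ 2 * JordanFour.hPrime k n a b c) := by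
      rw [JordanFour.toRingEquiv_zpowers_apply]
      exact smul_chartW₁_coeff k n σ a b c d e hab hac had hae hσb hσc hσd hσ g⁻¹
    have h := BlowupExit.map_away_eq_of_intertwines_deg sW₁ (sectionW₁_mem k n a b c d)
      (JordanFour.hPrime k n a b c ^ 2 * (JordanFour.tPrime k n a b c d ^ 2 * JordanFour.hPrime k n a b c))
      (coe_chartW₁_section k n a b c d) (φ g)
      ((MulSemiringAction.toRingEquiv (↥(Subgroup.zpowers σ)) (MvPolynomial (Fin n) k) g⁻¹ :
        _ ≃+* _) : _ →+* _) (hφ g) hcoeff (hP g) e' hnzd (τL ^ m g⁻¹).toRingHom (fun r => ?_) y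
    · exact h
    · change (τL ^ m g⁻¹) (e' (base₁ r)) = e' (base₁ _)
      rw [he'base, he'base, hmg]
      rfl
  -- the range conversion
  have hconv : ∀ y : BW₁, (∀ g, HomogeneousLocalization.map (φ g) (hP g) y = y) ↔ τL (e' y) = e' y := by
    intro y
    rw [← hfix (e' y)]
    constructor
    · intro h g
      have h1 := hengine g⁻¹ y
      rw [inv_inv, h g⁻¹] at h1
      exact h1.symm
    · intro h g
      apply he'inj
      rw [hengine, h g⁻¹]
  refine ⟨R₀, inferInstance, J₀, ψC, hinj, fun y => ?_, hrad, hreg, hJ⟩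
  have hy := hrangeτ y
  rw [RingHom.mem_range] at hy
  rw [Set.mem_range, hy, ← he', hconv]

end Summit.ResolutionOfSingularities.ResolutionOfSingularities.Theorems.WildQuotientResolution.JordanFive

end
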